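import Literature.Probability.LatticeModels.FieldCurrentsClusters
import HarnessLib

/-!
# Aizenman–Fernández 1986, Theorem 5.6 from Lemma 5.5: the lower bound on `∂M/∂β` for an abstract kernel

Topic `Probability/LatticeModels`, namespace `Literature.Probability.LatticeModels`. Sequel of
`FieldCurrentsClusters` (the lexicon `clusterWeight`, `corrIn`, `hclusterWeight` of
Aizenman–Fernández 1986, §3.3–3.4 and §5.1, for the `θ`-system on the ghost graph).

Aizenman–Fernández 1986 (J. Stat. Phys. **44**, 393–454), **Theorem 5.6** (eq. (5.19), p. 431): in a
finite translation-invariant ferromagnetic Ising system,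

  `∂M/∂β ≥ |M|J|χ - tanh(βh)|J|B₀χ|₊ / (1 + 2β|J|B₀)`,     `∂M/∂β = ½ ∑_{u,v} J_{uv} ⟨σ₀;σ_uσ_v⟩` (5.20),

where `B₀` is the bubble diagram at `h = 0`. The printed proof (pp. 431–434) combines the
random-current identities (3.15), (3.16), (5.1), (5.3), the switching lemma and a Schwarz
inequality with ONE input from the random-walk expansion of §4: **Lemma 5.5** (eq. (5.15), p. 429),
the bound on the depletion `⟨σ_v⟩ - ⟨σ_v⟩_{A^c}` of the magnetisation by the walk kernel `K` of
Def. 4.5, together with `K(x,y) ≤ ⟨σ_xσ_y⟩_{h=0}` (Prop. 4.7, (4.22)). This file proves the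
random-current part of that proof for an ABSTRACT kernel: every `K ≥ 0` satisfying the conclusion
of Lemma 5.5 and the bound (4.22) gives Theorem 5.6. The kernel properties enter as hypotheses of
the theorems (no named fact is introduced); the walk kernel itself (AF86 §4) is not constructed here.

## Contents

* `afSZero θ o u v = ∑_{S ∋ g} clusterWeight o u S · ⟨σ_v⟩_S` — one half of the truncated
  three-point function: `⟨σ_oσ_uσ_v⟩ - ⟨σ_o⟩⟨σ_uσ_v⟩ = afSZero o u v + afSZero o v u` ((3.16),
  `thetaCorr_triple_sub_eq_afSZero_add`), so that `∑_{(u,v) adjacent} afSZero o u v` is the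
  right-hand side of (5.20)/(5.21).
* `sum_clusterWeight_notMem_le` — the step (5.25)–(5.26) without the Schwarz inequality:
  `∑_{S ∋ g, S ∌ k} clusterWeight o u S ≤ ⟨σ_uσ_k⟩_{h=0} ⟨σ_o;σ_k⟩`.
* `sum_clusterWeight_corrIn_notMem_le` — the step (5.28)–(5.29):
  `∑_{S ∋ g, S ∌ k} clusterWeight o u S ⟨σ_l⟩_S ≤ ⟨σ_uσ_k⟩_{h=0} · afSZero o k l`
  (switch `{o,k}`, condition both sides on the `h`-cluster; the two conditioned sums share their
  outer factor and differ by the inner ratio `Z_T({u,k})/Z_T(∅) = ⟨σ_uσ_k⟩_T ≤ ⟨σ_uσ_k⟩_{h=0}`).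
* `torusDbeta_mul_ge_of_kernel` — **Theorem 5.6 on the discrete torus** `(ℤ/Lℤ)^d` for the
  nearest-neighbour model (tree parametrisation: coupling `β` per edge, field `βh`), for any kernel
  `K` with (K0) `K ≥ 0`, (K1) the depletion bound of Lemma 5.5 for the bond sets touching the
  complement of a set `S ∋ g`, (K2) `K(v,k) ≤ ⟨σ_vσ_k⟩_{h=0}`:
  `D_L (1 + tanh β · deg · B_L) ≥ deg · χ_L (M_L - tanh(βh) B_L)`, `deg` the degree of the torus graph,
  `D_L = ∑_{edges e} ⟨σ₀;σ_e⟩` (`torusDbeta`), `M_L`, `χ_L`, `B_L` the torus magnetisation,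
  susceptibility and zero-field bubble.

## Remark on the printed constant

The proof below gives the denominator `1 + tanh(β)|J|B₀ ≤ 1 + β|J|B₀`; the printed `1 + 2β|J|B₀` is
weaker. (In (5.30) the bond sum of (5.15) is taken over ordered pairs and compared with twice the
first summand of (5.20).)

## References

* M. Aizenman, R. Fernández, J. Stat. Phys. **44** (1986) 393–454: §4.3, Prop. 4.7, (4.22), p. 423;
  §5.1, Lemma 5.5, (5.15), p. 429; §5.2, Theorem 5.6, (5.19)–(5.30), pp. 431–434
  [AizenmanFernandezJSP1986] (author copy, PDF page = journal page − 392).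

## Mathlib

`Finset.sum_filter_of_ne`, `Finset.sum_le_sum_of_subset_of_nonneg`, `Finset.mul_sum`,
`ENNReal.toReal_mul`, `field_simp`, `nlinarith`.
-/

noncomputable section

open Finset MeasureTheory
open scoped symmDiff ENNReal

namespace Literature.Probability.LatticeModels

variable {V : Type*} [DecidableEq V]

section General

variable {G : SimpleGraph V} [G.LocallyFinite] {Λ : Finset V}

local notation "Gg" => ghostGraph G Λ
local notation "Λg" => Finset.insertNone Λ
local notation "Eg" => edgesIn (ghostGraph G Λ) (Finset.insertNone Λ)
local notation "Zg[" θ ", " X "]" =>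
  gcurrentZ (ghostGraph G Λ) (Finset.insertNone Λ) θ (edgesIn (ghostGraph G Λ) (Finset.insertNone Λ)) X
local notation "ZIn[" θ ", " S ", " X "]" =>
  gcurrentZ (ghostGraph G Λ) (Finset.insertNone Λ) θ (edgesIn (ghostGraph G Λ) S) X
local notation "Conn[" m ", " u ", " v "]" =>
  CConn (ghostGraph G Λ) (Finset.insertNone Λ) m (edgesIn (ghostGraph G Λ) (Finset.insertNone Λ)) u v
local notation "∂g" => csources (ghostGraph G Λ) (Finset.insertNone Λ)
local notation "𝒮[" m ", " b "]" => clusterCompl (ghostGraph G Λ) (Finset.insertNone Λ) m b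

/-! ### `afSZero`: one half of `⟨σ_o; σ_uσ_v⟩` -/

variable (G Λ) in
/-- **One half of the truncated three-point function**, resolved over the cluster of `o`:
`afSZero θ o u v = ∑_{S ⊆ Λ ∪ {g}, g ∈ S} clusterWeight θ o u S · ⟨σ_v⟩_S`, i.e.
`Z⁻² ∑_{∂n₁ = ({o}∆{u})*, ∂n₂ = ∅} w w 𝟙[o ↮ g] ⟨σ_v⟩_{C^c_{n₁+n₂}(o)}` — the first summand of
Aizenman–Fernández 1986, (3.16) (for `⟨σ_o; σ_uσ_v⟩`) and of (5.21) (for `∂M/∂β`). [cite: AizenmanFernandezJSP1986, §3.4, Cor. 3.5, eq. (3.16), p. 413, and §5.2, eq. (5.21), p. 431] -/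
def afSZero (θ : Sym2 (Option V) → ℝ) (o u v : V) : ℝ :=
  ∑ S ∈ (Λg).powerset.filter (fun S => (none : Option V) ∈ S),
    clusterWeight G Λ θ o u S * corrIn G Λ θ S {v}

/-- `afSZero ≥ 0`. [folklore] -/
theorem afSZero_nonneg {θ : Sym2 (Option V) → ℝ} (hθ : ∀ e, 0 ≤ θ e) (o u : V) {v : V} (hv : v ∈ Λ) :
    0 ≤ afSZero G Λ θ o u v :=
  sum_nonneg fun S _ => mul_nonneg (clusterWeight_nonneg θ o u S) (corrIn_nonneg hθ S (singleton_subset_iff.2 hv))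

/-- The terms of `afSZero` vanish off the side conditions `g, v ∈ S`, `o, u ∉ S`. [folklore] -/
theorem clusterWeight_mul_corrIn_eq_zero {θ : Sym2 (Option V) → ℝ} (hθ : ∀ e, 0 ≤ θ e) {o u v : V} (hv : v ∈ Λ)
    {S : Finset (Option V)} (hSΛ : S ⊆ Λg) (hn : (none : Option V) ∈ S) (hS : ¬Claim1Side o u v S) :
    clusterWeight G Λ θ o u S * corrIn G Λ θ S {v} = 0 := by
  unfold Claim1Side at hS
  by_cases hvS : (some v : Option V) ∈ S
  · have hou : (some o : Option V) ∈ S ∨ (some u : Option V) ∈ S := by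
      by_contra h
      exact hS ⟨hn, hvS, fun h' => h (Or.inl h'), fun h' => h (Or.inr h')⟩
    rw [clusterWeight_eq_zero_of_mem hou, zero_mul]
  · rw [corrIn_singleton_eq_zero hθ hSΛ hv hvS, mul_zero]

/-- `afSZero` as the sum over the side conditions (the sum `∑_{S: g,v ∈ S; o,u ∉ S}` of
`thetaCorr_triple_sub_eq_sum`). [cite: AizenmanFernandezJSP1986, §3.4, eqs. (3.13)–(3.16)] -/
theorem afSZero_eq_sum_claim1Side {θ : Sym2 (Option V) → ℝ} (hθ : ∀ e, 0 ≤ θ e) (o u : V) {v : V} (hv : v ∈ Λ) :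
    afSZero G Λ θ o u v =
      ∑ S ∈ (Λg).powerset.filter (Claim1Side o u v), corrIn G Λ θ S {v} * clusterWeight G Λ θ o u S := by
  unfold afSZero
  have hsub : (Λg).powerset.filter (Claim1Side o u v) =
      ((Λg).powerset.filter (fun S => (none : Option V) ∈ S)).filter (Claim1Side o u v) := by
    rw [filter_filter]
    exact filter_congr fun S _ => ⟨fun h => ⟨h.1, h⟩, fun h => h.2⟩
  have hzero : ∀ S ∈ (Λg).powerset.filter (fun S => (none : Option V) ∈ S),
      corrIn G Λ θ S {v} * clusterWeight G Λ θ o u S ≠ 0 → Claim1Side o u v S := by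
    intro S hS hne
    rw [mem_filter, mem_powerset] at hS
    by_contra hC
    exact hne (by rw [mul_comm]; exact clusterWeight_mul_corrIn_eq_zero hθ hv hS.1 hS.2 hC)
  rw [hsub, sum_filter_of_ne hzero]
  exact sum_congr rfl fun S _ => mul_comm _ _

/-- On the diagonal `afSZero θ o u u = 0` (the site `u` lies in the cluster of `o`). [folklore] -/
theorem afSZero_self {θ : Sym2 (Option V) → ℝ} (hθ : ∀ e, 0 ≤ θ e) (o : V) {u : V} (hu : u ∈ Λ) :
    afSZero G Λ θ o u u = 0 := by
  rw [afSZero_eq_sum_claim1Side hθ o u hu]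
  refine sum_eq_zero fun S hS => ?_
  obtain ⟨-, huS, -, huS'⟩ := (mem_filter.1 hS).2
  exact absurd huS huS'

/-- **(3.16) in terms of `afSZero`**: for `o, u, v ∈ Λ`, `u ≠ v`,
`⟨σ_oσ_uσ_v⟩ - ⟨σ_o⟩⟨σ_uσ_v⟩ = afSZero o u v + afSZero o v u`. [cite: AizenmanFernandezJSP1986, §3.4, Cor. 3.5, eq. (3.16), p. 413] -/
theorem thetaCorr_triple_sub_eq_afSZero_add {θ : Sym2 (Option V) → ℝ} (hθ : ∀ e, 0 ≤ θ e) {o u v : V}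
    (ho : o ∈ Λ) (hu : u ∈ Λ) (hv : v ∈ Λ) (huv : u ≠ v) :
    thetaCorr G Λ θ ({o} ∆ ({u} ∆ {v})) - thetaCorr G Λ θ {o} * thetaCorr G Λ θ ({u} ∆ {v}) =
      afSZero G Λ θ o u v + afSZero G Λ θ o v u := by
  rw [thetaCorr_triple_sub_eq_sum hθ ho hu hv huv, afSZero_eq_sum_claim1Side hθ o u hv,
    afSZero_eq_sum_claim1Side hθ o v hu]

/-- **The mass of the cluster weights on `{g ∈ S}` is the truncated pair function** ((3.15)):
`∑_{S ∋ g} clusterWeight o u S = ⟨σ_oσ_u⟩ - ⟨σ_o⟩⟨σ_u⟩`. [cite: AizenmanFernandezJSP1986, §3.4, Cor. 3.5, eq. (3.15), p. 413] -/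
theorem sum_clusterWeight_none_eq {θ : Sym2 (Option V) → ℝ} (hθ : ∀ e, 0 ≤ θ e) {o u : V} (ho : o ∈ Λ)
    (hu : u ∈ Λ) :
    ∑ S ∈ (Λg).powerset.filter (fun S => (none : Option V) ∈ S), clusterWeight G Λ θ o u S =
      thetaCorr G Λ θ ({o} ∆ {u}) - thetaCorr G Λ θ {o} * thetaCorr G Λ θ {u} :=
  (thetaCorr_pair_sub_eq_sum_clusterWeight hθ ho hu).symm

/-! ### The step (5.25)–(5.26): the weight of `{o ↮ g, o ⟷ k}` -/

/-- **Aizenman–Fernández (5.25)–(5.26), before the Schwarz inequality**: for `o, u, k ∈ Λ`,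
`∑_{S ∋ g, S ∌ k} clusterWeight o u S ≤ ⟨σ_uσ_k⟩_{h=0} · (⟨σ_oσ_k⟩ - ⟨σ_o⟩⟨σ_k⟩)`
(resolve over the `h`-cluster, `⟨σ_uσ_k⟩_{C^c(h)} ≤ ⟨σ_uσ_k⟩_{h=0}` by Griffiths II, then (5.3)). [cite: AizenmanFernandezJSP1986, §5.2, proof of Thm. 5.6, eqs. (5.25)–(5.26), p. 432] -/
theorem sum_clusterWeight_notMem_le {θ : Sym2 (Option V) → ℝ} (hθ : ∀ e, 0 ≤ θ e) {o u k : V}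
    (ho : o ∈ Λ) (hu : u ∈ Λ) (hk : k ∈ Λ) :
    ∑ S ∈ (Λg).powerset.filter (fun S => (none : Option V) ∈ S ∧ (some k : Option V) ∉ S),
        clusterWeight G Λ θ o u S ≤
      thetaCorr G Λ (zeroField θ) ({u} ∆ {k}) *
        (thetaCorr G Λ θ ({o} ∆ {k}) - thetaCorr G Λ θ {o} * thetaCorr G Λ θ {k}) := by
  rw [sum_clusterWeight_notMem_eq_sum_hcluster hθ ho hu hk, ← sum_hclusterWeight_mul_corrIn_pair hθ ho hk,
    mul_sum]
  have huk : ({u} ∆ {k} : Finset V) ⊆ Λ :=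
    symmDiff_le_sup.trans (sup_le (singleton_subset_iff.2 hu) (singleton_subset_iff.2 hk))
  have hok : ({o} ∆ {k} : Finset V) ⊆ Λ :=
    symmDiff_le_sup.trans (sup_le (singleton_subset_iff.2 ho) (singleton_subset_iff.2 hk))
  have hzf0 : 0 ≤ thetaCorr G Λ (zeroField θ) ({u} ∆ {k}) := thetaCorr_nonneg (zeroField_nonneg hθ) huk
  calc ∑ S' ∈ Λ.powerset.filter (fun S' => o ∈ S' ∧ k ∈ S' ∧ u ∈ S'),
        hclusterWeight G Λ θ S' * (corrIn G Λ θ (S'.map Function.Embedding.some) ({o} ∆ {k}) *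
          corrIn G Λ θ (S'.map Function.Embedding.some) ({u} ∆ {k}))
      ≤ ∑ S' ∈ Λ.powerset.filter (fun S' => o ∈ S' ∧ k ∈ S' ∧ u ∈ S'),
          thetaCorr G Λ (zeroField θ) ({u} ∆ {k}) *
            (hclusterWeight G Λ θ S' * corrIn G Λ θ (S'.map Function.Embedding.some) ({o} ∆ {k})) := by
        refine sum_le_sum fun S' _ => ?_
        have h1 := corrIn_map_le_zeroField (G := G) (Λ := Λ) hθ S' huk
        have h2 := hclusterWeight_nonneg (G := G) (Λ := Λ) θ S'
        have h3 := corrIn_nonneg (G := G) (Λ := Λ) hθ (S'.map Function.Embedding.some) hok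
        calc hclusterWeight G Λ θ S' * (corrIn G Λ θ (S'.map Function.Embedding.some) ({o} ∆ {k}) *
              corrIn G Λ θ (S'.map Function.Embedding.some) ({u} ∆ {k}))
            = (hclusterWeight G Λ θ S' * corrIn G Λ θ (S'.map Function.Embedding.some) ({o} ∆ {k})) *
                corrIn G Λ θ (S'.map Function.Embedding.some) ({u} ∆ {k}) := by ring
          _ ≤ (hclusterWeight G Λ θ S' * corrIn G Λ θ (S'.map Function.Embedding.some) ({o} ∆ {k})) *
                thetaCorr G Λ (zeroField θ) ({u} ∆ {k}) :=
              mul_le_mul_of_nonneg_left h1 (mul_nonneg h2 h3)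
          _ = _ := by ring
    _ ≤ ∑ S' ∈ Λ.powerset.filter (fun S' => o ∈ S' ∧ k ∈ S'),
          thetaCorr G Λ (zeroField θ) ({u} ∆ {k}) *
            (hclusterWeight G Λ θ S' * corrIn G Λ θ (S'.map Function.Embedding.some) ({o} ∆ {k})) := by
        refine sum_le_sum_of_subset_of_nonneg (fun S' hS' => ?_) (fun S' _ _ => ?_)
        · rw [mem_filter] at hS' ⊢
          exact ⟨hS'.1, hS'.2.1, hS'.2.2.1⟩
        · exact mul_nonneg hzf0 (mul_nonneg (hclusterWeight_nonneg θ S')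
            (corrIn_nonneg hθ (S'.map Function.Embedding.some) hok))

/-! ### Finite-set bookkeeping for the source sets `({a}∆{k})* ∪ {l}*` -/

/-- Membership in the lifted singleton `{l}* = {some l} ∆ {none}`. [folklore] -/
theorem mem_some_symmDiff_none {l : V} {v : Option V} :
    v ∈ ({some l} ∆ {none} : Finset (Option V)) ↔ v = some l ∨ v = none := by
  rw [mem_symmDiff, mem_singleton, mem_singleton]
  constructor
  · rintro (⟨h, -⟩ | ⟨h, -⟩)
    · exact Or.inl h
    · exact Or.inr h
  · rintro (rfl | rfl)
    · exact Or.inl ⟨rfl, fun h => Option.some_ne_none l h⟩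
    · exact Or.inr ⟨rfl, fun h => Option.some_ne_none l h.symm⟩

/-- For `a, k ≠ l` the lifted pair `{some a} ∆ {some k}` is disjoint from `{l}*`. [folklore] -/
theorem disjoint_pair_ghostPair {a k l : V} (hal : a ≠ l) (hkl : k ≠ l) :
    Disjoint ({some a} ∆ {some k} : Finset (Option V)) ({some l} ∆ {none}) := by
  rw [disjoint_left]
  intro v hv hv'
  rw [mem_some_symmDiff_none] at hv'
  rw [mem_symmDiff, mem_singleton, mem_singleton] at hv
  rcases hv' with rfl | rfl
  · rcases hv with ⟨h, -⟩ | ⟨h, -⟩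
    · exact hal (Option.some_injective _ h).symm
    · exact hkl (Option.some_injective _ h).symm
  · rcases hv with ⟨h, -⟩ | ⟨h, -⟩
    · exact Option.some_ne_none a h.symm
    · exact Option.some_ne_none k h.symm

/-- Filtering a disjoint union by a predicate true on the first part and false on the second. [folklore] -/
theorem filter_union_of_forall {α : Type*} [DecidableEq α] {A B : Finset α} (p : α → Prop) [DecidablePred p]
    (hA : ∀ a ∈ A, p a) (hB : ∀ b ∈ B, ¬p b) : (A ∪ B).filter p = A := by
  rw [filter_union, filter_true_of_mem hA, filter_false_of_mem hB, union_empty]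

/-- The source set `X(a) = ({some a} ∆ {some k}) ∆ {l}*` is the disjoint union of its two parts. [folklore] -/
theorem pair_symmDiff_ghostPair_eq_union {a k l : V} (hal : a ≠ l) (hkl : k ≠ l) :
    (({some a} ∆ {some k}) ∆ ({some l} ∆ {none}) : Finset (Option V)) =
      ({some a} ∆ {some k}) ∪ ({some l} ∆ {none}) :=
  (disjoint_pair_ghostPair hal hkl).symmDiff_eq_sup

/-- Filters of `X(a)` by membership in a set containing `{l}*` and missing `a, k`. [folklore] -/
theorem filter_pair_symmDiff_ghostPair_of_ghost_mem {a k l : V} (hal : a ≠ l) (hkl : k ≠ l) {W : Finset (Option V)}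
    (haW : (some a : Option V) ∉ W) (hkW : (some k : Option V) ∉ W) (hlW : (some l : Option V) ∈ W)
    (hnW : (none : Option V) ∈ W) :
    ((({some a} ∆ {some k}) ∆ ({some l} ∆ {none}) : Finset (Option V))).filter (· ∈ W) = {some l} ∆ {none} ∧
      ((({some a} ∆ {some k}) ∆ ({some l} ∆ {none}) : Finset (Option V))).filter (· ∉ W) = {some a} ∆ {some k} := by
  have hA : ∀ v ∈ ({some a} ∆ {some k} : Finset (Option V)), v ∉ W := by
    intro v hv
    rw [mem_symmDiff, mem_singleton, mem_singleton] at hv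
    rcases hv with ⟨rfl, -⟩ | ⟨rfl, -⟩
    · exact haW
    · exact hkW
  have hB : ∀ v ∈ ({some l} ∆ {none} : Finset (Option V)), v ∈ W := by
    intro v hv
    rcases mem_some_symmDiff_none.1 hv with rfl | rfl
    · exact hlW
    · exact hnW
  rw [pair_symmDiff_ghostPair_eq_union hal hkl]
  constructor
  · rw [union_comm]
    exact filter_union_of_forall _ hB hA
  · exact filter_union_of_forall _ hA (fun v hv => not_not.2 (hB v hv))

/-- Filters of `X(a)` by membership in a set containing `a, k` and missing `{l}*`. [folklore] -/
theorem filter_pair_symmDiff_ghostPair_of_ghost_not_mem {a k l : V} (hal : a ≠ l) (hkl : k ≠ l) {W : Finset (Option V)}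
    (haW : (some a : Option V) ∈ W) (hkW : (some k : Option V) ∈ W) (hlW : (some l : Option V) ∉ W)
    (hnW : (none : Option V) ∉ W) :
    ((({some a} ∆ {some k}) ∆ ({some l} ∆ {none}) : Finset (Option V))).filter (· ∈ W) = {some a} ∆ {some k} ∧
      ((({some a} ∆ {some k}) ∆ ({some l} ∆ {none}) : Finset (Option V))).filter (· ∉ W) = {some l} ∆ {none} := by
  have hA : ∀ v ∈ ({some a} ∆ {some k} : Finset (Option V)), v ∈ W := by
    intro v hv
    rw [mem_symmDiff, mem_singleton, mem_singleton] at hv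
    rcases hv with ⟨rfl, -⟩ | ⟨rfl, -⟩
    · exact haW
    · exact hkW
  have hB : ∀ v ∈ ({some l} ∆ {none} : Finset (Option V)), v ∉ W := by
    intro v hv
    rcases mem_some_symmDiff_none.1 hv with rfl | rfl
    · exact hlW
    · exact hnW
  rw [pair_symmDiff_ghostPair_eq_union hal hkl]
  constructor
  · exact filter_union_of_forall _ hA hB
  · rw [union_comm]
    exact filter_union_of_forall _ hB (fun v hv => not_not.2 (hA v hv))

/-! ### Stripping a depleted one-point function into the sources (Lemma 3.3 at `b = o`) -/

/-- **Re-inserting `⟨σ_l⟩_S` as sources `{l}*`** (Aizenman–Fernández's Lemma 3.3 at the cluster of `o`,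
read backwards): on `{𝒮_o = S}` with `g, l ∈ S` and all of `P`, `Y` outside `S`,
`⟨σ_l⟩_S · Z⁻⁰∑_{P, Y} w w 𝟙[𝒮_o = S] = ∑_{P ∪ {l}*, Y} w w 𝟙[𝒮_o = S]` (in `ℝ`). [cite: AizenmanFernandezJSP1986, §3.3, Lemma 3.3, eq. (3.11), p. 411] -/
theorem toReal_pairSum_union_ghostPair_eq {θ : Sym2 (Option V) → ℝ} (hθ : ∀ e, 0 ≤ θ e) {S : Finset (Option V)}
    (hS : S ⊆ Λg) {o l : V} (ho : o ∈ Λ) (hoS : (some o : Option V) ∉ S) (hl : l ∈ Λ)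
    (hlS : (some l : Option V) ∈ S) (hnS : (none : Option V) ∈ S) {a k : V} (hal : a ≠ l) (hkl : k ≠ l)
    (haS : (some a : Option V) ∉ S) (hkS : (some k : Option V) ∉ S) {Y : Finset (Option V)}
    (hY : ∀ v ∈ Y, v ∉ S) :
    (currentPairSum G Λ θ (({some a} ∆ {some k}) ∆ ({some l} ∆ {none})) Y (fun m => ind (𝒮[m, some o] = S))).toReal =
      corrIn G Λ θ S {l} *
        (currentPairSum G Λ θ ({some a} ∆ {some k}) Y (fun m => ind (𝒮[m, some o] = S))).toReal := by
  have hb : (some o : Option V) ∈ Λg \ S := mem_sdiff.2 ⟨Finset.some_mem_insertNone.2 ho, hoS⟩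
  have hstrip := currentPairSum_clusterCompl_strip (G := G) (Λ := Λ) θ hS hb
    (({some a} ∆ {some k}) ∆ ({some l} ∆ {none})) Y
  obtain ⟨hf1, hf2⟩ := filter_pair_symmDiff_ghostPair_of_ghost_mem (V := V) hal hkl haS hkS hlS hnS
  rw [hf1, hf2, filter_false_of_mem hY, filter_true_of_mem hY] at hstrip
  have hpos := toReal_gcurrentZ_in_pos (G := G) (Λ := Λ) hθ hS
  have h1 := congrArg ENNReal.toReal hstrip
  rw [ENNReal.toReal_mul, ENNReal.toReal_mul, ENNReal.toReal_mul, ENNReal.toReal_mul] at h1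
  rw [corrIn_eq_gcurrentZ_div hθ hS (singleton_subset_iff.2 hl), starSet_singleton]
  field_simp
  nlinarith [h1, hpos]

/-! ### Switching `{o, k}` at a fixed cluster of `o` -/

/-- **Switching the pair `{o, k}` on `{𝒮_o = S}` with `k ∉ S`**:
`∑_{({o}∆{u})*, ∅} w w 𝟙[𝒮_o = S] = ∑_{{u*}∆{k*}, {o*}∆{k*}} w w 𝟙[𝒮_o = S]`
(on the event, `o ⟷ k`, so the switching indicator is `1`; Aizenman–Fernández 1986, the switching
behind (5.28)–(5.29)). [cite: AizenmanFernandezJSP1986, §5.2, proof of Thm. 5.6, eqs. (5.28)–(5.29), p. 433] -/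
theorem currentPairSum_starSet_pair_clusterCompl_switch {θ : Sym2 (Option V) → ℝ} (hθ : ∀ e, 0 ≤ θ e)
    {S : Finset (Option V)} {o u k : V} (hk : k ∈ Λ) (hkS : (some k : Option V) ∉ S) :
    currentPairSum G Λ θ (starSet ({o} ∆ {u})) ∅ (fun m => ind (𝒮[m, some o] = S)) =
      currentPairSum G Λ θ ({some u} ∆ {some k}) ({some o} ∆ {some k}) (fun m => ind (𝒮[m, some o] = S)) := by
  have hsw := currentPairSum_switching (G := G) (Λ := Λ) hθ ({some o} ∆ {some u}) (some o) (some k)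
    (fun m => ind (𝒮[m, some o] = S))
  have hcancel : ((({some o} ∆ {some u}) ∆ ({some o} ∆ {some k})) : Finset (Option V)) = {some u} ∆ {some k} := by
    ext v; simp only [mem_symmDiff, mem_singleton]; tauto
  rw [hcancel] at hsw
  rw [starSet_pair, hsw]
  refine currentPairSum_congr fun n₁ n₂ _ _ => ?_
  by_cases hS' : 𝒮[n₁ + n₂, some o] = S
  · have hconn : Conn[n₁ + n₂, some o, some k] := by
      have : (some k : Option V) ∉ 𝒮[n₁ + n₂, some o] := hS' ▸ hkS
      rwa [some_mem_clusterCompl_iff hk, not_not] at this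
    rw [ind_of_true hS', ind_of_true hconn, mul_one]
  · rw [ind_of_false hS', zero_mul]

/-! ### Parity bookkeeping: the events in terms of the `h`-cluster -/

/-- In a finite set of even cardinality every element has a companion. [folklore] -/
theorem exists_ne_of_even_card {α : Type*} {F : Finset α} (hE : Even #F) {a : α} (ha : a ∈ F) :
    ∃ b ∈ F, b ≠ a := by
  by_contra h
  push Not at h
  have hF : F = {a} := eq_singleton_iff_unique_mem.2 ⟨ha, h⟩
  rw [hF, card_singleton] at hE
  exact Nat.not_even_one hE

/-- Membership in `X(a) = ({some a} ∆ {some k}) ∆ {l}*` for `a, k ≠ l`. [folklore] -/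
theorem mem_pair_symmDiff_ghostPair {a k l : V} (hal : a ≠ l) (hkl : k ≠ l) {v : Option V} :
    v ∈ ((({some a} ∆ {some k}) ∆ ({some l} ∆ {none})) : Finset (Option V)) ↔
      v ∈ ({some a} ∆ {some k} : Finset (Option V)) ∨ v = some l ∨ v = none := by
  rw [pair_symmDiff_ghostPair_eq_union hal hkl, mem_union, mem_some_symmDiff_none]

/-- Membership in a lifted pair. [folklore] -/
theorem mem_some_symmDiff_some {a k : V} {v : Option V} :
    v ∈ ({some a} ∆ {some k} : Finset (Option V)) → v = some a ∨ v = some k := by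
  rw [mem_symmDiff, mem_singleton, mem_singleton]
  rintro (⟨h, -⟩ | ⟨h, -⟩)
  · exact Or.inl h
  · exact Or.inr h

/-- The sources `{o*} ∆ {k*}` of the second current join `o` to `k`. [folklore] -/
theorem cconn_of_csources_pair {n m : Eg → ℕ} (hle : n ≤ m) {o k : V}
    (h2 : ∂g n = ({some o} ∆ {some k} : Finset (Option V))) : Conn[m, some o, some k] := by
  by_cases hok : o = k
  · subst hok; exact Relation.ReflTransGen.refl
  · exact (cconn_of_csources_eq (fun h => hok (Option.some_injective _ h)) h2).mono hle

/-- **The event of (5.28)–(5.29) read on the `h`-cluster.** For currents with sources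
`∂n₁ = ({u*}∆{k*}) ∆ {l}*`, `∂n₂ = {o*} ∆ {k*}` (`u, k, o ≠ l`), the event
`{g, l ∈ 𝒮_o; o, u, k ∉ 𝒮_o}` (i.e. `o ↮ g`, `o ↮ l`, `o ⟷ u`, `o ⟷ k`) coincides with
`{o, u, k ↮ g, l ⟷ g}`: parity of the sources of `n₁` in the clusters of `l` and of `o`. [cite: AizenmanFernandezJSP1986, §5.2, proof of Thm. 5.6, Claim (5.29) and its proof, p. 433] -/
theorem claim1Side_and_iff_hcluster {n₁ n₂ : Eg → ℕ} {o u k l : V} (hu : u ∈ Λ) (hk : k ∈ Λ) (hl : l ∈ Λ)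
    (hul : u ≠ l) (hkl : k ≠ l)
    (h1 : ∂g n₁ = ((({some u} ∆ {some k}) ∆ ({some l} ∆ {none})) : Finset (Option V)))
    (h2 : ∂g n₂ = ({some o} ∆ {some k} : Finset (Option V))) :
    (Claim1Side o u l (𝒮[n₁ + n₂, some o]) ∧ (some k : Option V) ∉ 𝒮[n₁ + n₂, some o]) ↔
      (¬Conn[n₁ + n₂, some o, none] ∧ ¬Conn[n₁ + n₂, some u, none] ∧ ¬Conn[n₁ + n₂, some k, none] ∧
        Conn[n₁ + n₂, some l, none]) := by
  classical
  set m := n₁ + n₂ with hm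
  have hle1 : n₁ ≤ m := fun e => Nat.le_add_right _ _
  have hle2 : n₂ ≤ m := fun e => Nat.le_add_left _ _
  have hok : Conn[m, some o, some k] := cconn_of_csources_pair hle2 h2
  rw [claim1Side_clusterCompl_iff hu hl, some_mem_clusterCompl_iff hk, not_not]
  -- parity of the sources of `n₁` in a cluster of `m`
  have hpar : ∀ b : Option V, Even #(((({some u} ∆ {some k}) ∆ ({some l} ∆ {none})) : Finset (Option V)).filter
      fun v => Conn[m, b, v]) := by
    intro b
    have := even_card_csources_filter_cconn (G := Gg) (Λ := Λg) hle1 b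
    rw [h1] at this
    convert this using 2
  constructor
  · rintro ⟨⟨hog, hol, hou⟩, -⟩
    refine ⟨hog, fun h => hog (hou.trans h), fun h => hog (hok.trans h), ?_⟩
    by_contra hlg
    have hlmem : (some l : Option V) ∈ ((({some u} ∆ {some k}) ∆ ({some l} ∆ {none})) : Finset (Option V)).filter
        fun v => Conn[m, some l, v] :=
      mem_filter.2 ⟨(mem_pair_symmDiff_ghostPair hul hkl).2 (Or.inr (Or.inl rfl)), Relation.ReflTransGen.refl⟩
    obtain ⟨v, hv, hvl⟩ := exists_ne_of_even_card (hpar (some l)) hlmem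
    obtain ⟨hvX, hlv⟩ := mem_filter.1 hv
    rcases (mem_pair_symmDiff_ghostPair hul hkl).1 hvX with hvp | rfl | rfl
    · rcases mem_some_symmDiff_some hvp with rfl | rfl
      · exact hol (hou.trans hlv.symm)
      · exact hol (hok.trans hlv.symm)
    · exact hvl rfl
    · exact hlg hlv
  · rintro ⟨hog, -, -, hlg⟩
    refine ⟨⟨hog, fun h => hog (h.trans hlg), ?_⟩, hok⟩
    by_cases huk : u = k
    · rw [huk]; exact hok
    by_contra hou
    have hkmem : (some k : Option V) ∈ ((({some u} ∆ {some k}) ∆ ({some l} ∆ {none})) : Finset (Option V)).filter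
        fun v => Conn[m, some o, v] := by
      refine mem_filter.2 ⟨(mem_pair_symmDiff_ghostPair hul hkl).2 (Or.inl ?_), hok⟩
      rw [mem_symmDiff, mem_singleton, mem_singleton]
      exact Or.inr ⟨rfl, fun h => huk (Option.some_injective _ h).symm⟩
    obtain ⟨v, hv, hvk⟩ := exists_ne_of_even_card (hpar (some o)) hkmem
    obtain ⟨hvX, hov⟩ := mem_filter.1 hv
    rcases (mem_pair_symmDiff_ghostPair hul hkl).1 hvX with hvp | rfl | rfl
    · rcases mem_some_symmDiff_some hvp with rfl | rfl
      · exact hou hov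
      · exact hvk rfl
    · exact hog (hov.trans hlg)
    · exact hog hov

/-- **The event of `δ_{k,l}` read on the `h`-cluster.** For currents with sources
`∂n₁ = ({o*}∆{k*}) ∆ {l}*` (`= (okl)*`), `∂n₂ = ∅` (`o, k ≠ l`), the event
`{o ↮ g, o ↮ l, o ⟷ k}` coincides with `{o, k ↮ g, l ⟷ g}`. [cite: AizenmanFernandezJSP1986, §5.2, proof of Thm. 5.6, Claim (5.29) and its proof, p. 433] -/
theorem dctDeltaEvent_iff_hcluster {n₁ n₂ : Eg → ℕ} {o k l : V} (hol : o ≠ l) (hkl : k ≠ l)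
    (h1 : ∂g n₁ = ((({some o} ∆ {some k}) ∆ ({some l} ∆ {none})) : Finset (Option V))) :
    (¬Conn[n₁ + n₂, some o, none] ∧ ¬Conn[n₁ + n₂, some o, some l] ∧ Conn[n₁ + n₂, some o, some k]) ↔
      (¬Conn[n₁ + n₂, some o, none] ∧ ¬Conn[n₁ + n₂, some k, none] ∧ Conn[n₁ + n₂, some l, none]) := by
  classical
  set m := n₁ + n₂ with hm
  have hle1 : n₁ ≤ m := fun e => Nat.le_add_right _ _
  have hpar : ∀ b : Option V, Even #(((({some o} ∆ {some k}) ∆ ({some l} ∆ {none})) : Finset (Option V)).filter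
      fun v => Conn[m, b, v]) := by
    intro b
    have := even_card_csources_filter_cconn (G := Gg) (Λ := Λg) hle1 b
    rw [h1] at this
    convert this using 2
  constructor
  · rintro ⟨hog, hol', hok⟩
    refine ⟨hog, fun h => hog (hok.trans h), ?_⟩
    by_contra hlg
    have hlmem : (some l : Option V) ∈ ((({some o} ∆ {some k}) ∆ ({some l} ∆ {none})) : Finset (Option V)).filter
        fun v => Conn[m, some l, v] :=
      mem_filter.2 ⟨(mem_pair_symmDiff_ghostPair hol hkl).2 (Or.inr (Or.inl rfl)), Relation.ReflTransGen.refl⟩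
    obtain ⟨v, hv, hvl⟩ := exists_ne_of_even_card (hpar (some l)) hlmem
    obtain ⟨hvX, hlv⟩ := mem_filter.1 hv
    rcases (mem_pair_symmDiff_ghostPair hol hkl).1 hvX with hvp | rfl | rfl
    · rcases mem_some_symmDiff_some hvp with rfl | rfl
      · exact hol' hlv.symm
      · exact hol' (hok.trans hlv.symm)
    · exact hvl rfl
    · exact hlg hlv
  · rintro ⟨hog, -, hlg⟩
    refine ⟨hog, fun h => hog (h.trans hlg), ?_⟩
    by_cases hok' : o = k
    · subst hok'; exact Relation.ReflTransGen.refl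
    by_contra hok
    have homem : (some o : Option V) ∈ ((({some o} ∆ {some k}) ∆ ({some l} ∆ {none})) : Finset (Option V)).filter
        fun v => Conn[m, some o, v] := by
      refine mem_filter.2 ⟨(mem_pair_symmDiff_ghostPair hol hkl).2 (Or.inl ?_), Relation.ReflTransGen.refl⟩
      rw [mem_symmDiff, mem_singleton, mem_singleton]
      exact Or.inl ⟨rfl, fun h => hok' (Option.some_injective _ h)⟩
    obtain ⟨v, hv, hvo⟩ := exists_ne_of_even_card (hpar (some o)) homem
    obtain ⟨hvX, hov⟩ := mem_filter.1 hv
    rcases (mem_pair_symmDiff_ghostPair hol hkl).1 hvX with hvp | rfl | rfl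
    · rcases mem_some_symmDiff_some hvp with rfl | rfl
      · exact hvo rfl
      · exact hok hov
    · exact hog (hov.trans hlg)
    · exact hog hov

/-! ### Decomposition over the `h`-cluster and the per-cluster factorisation -/

/-- **Decomposition of a pair sum over the values of `𝒮_g`** for an event expressed through
`𝒮_g`: `∑ w w 𝟙[E] = ∑_{T' ⊆ Λ, Q(T')} ∑ w w 𝟙[𝒮_g = T'*]` when `E ⟺ Q(𝒮_g ∖ {g})` on the sources. [cite: AizenmanFernandezJSP1986, §5.1, Lemma 5.1, eq. (5.1), p. 425] -/
theorem currentPairSum_ind_eq_sum_hcluster (θ : Sym2 (Option V) → ℝ) {X Y : Finset (Option V)}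
    (Q : Finset V → Prop) [DecidablePred Q] {E : (Eg → ℕ) → Prop}
    (hE : ∀ n₁ n₂, ∂g n₁ = X → ∂g n₂ = Y → (E (n₁ + n₂) ↔ Q (Finset.eraseNone (𝒮[n₁ + n₂, none])))) :
    currentPairSum G Λ θ X Y (fun m => ind (E m)) =
      ∑ T' ∈ Λ.powerset.filter Q,
        currentPairSum G Λ θ X Y (fun m => ind (𝒮[m, none] = T'.map Function.Embedding.some)) := by
  rw [← currentPairSum_finset_sum]
  refine currentPairSum_congr fun n₁ n₂ h1 h2 => ?_
  rw [sum_ind_clusterCompl_none]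
  exact ind_congr (hE n₁ n₂ h1 h2)

/-- **Factorisation on `{𝒮_g = T'*}` of a pair sum with first sources `X(a) = ({a*}∆{k*}) ∆ {l}*`**
(`a, k ∈ T'`, `l ∉ T'`, second sources inside `T'*`): the sources `{a*}∆{k*}` and `Y` live in the
zero-field system inside `T'*`, the sources `{l}*` in the outer factor (Aizenman–Fernández 1986,
Lemma 3.3 at the `h`-cluster). [cite: AizenmanFernandezJSP1986, §3.3, Lemma 3.3, eq. (3.11), p. 411, and §5.1, eq. (5.1)] -/
theorem currentPairSum_pairGhost_hcluster_eq (θ : Sym2 (Option V) → ℝ) {T' : Finset V} (hT' : T' ⊆ Λ)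
    {a k l : V} (ha : a ∈ T') (hk : k ∈ T') (hl : l ∉ T') (hal : a ≠ l) (hkl : k ≠ l)
    {Y : Finset (Option V)} (hY : ∀ v ∈ Y, v ∈ T'.map Function.Embedding.some) :
    currentPairSum G Λ θ (({some a} ∆ {some k}) ∆ ({some l} ∆ {none})) Y
        (fun m => ind (𝒮[m, none] = T'.map Function.Embedding.some)) =
      ZIn[θ, T'.map Function.Embedding.some, {some a} ∆ {some k}] *
        ZIn[θ, T'.map Function.Embedding.some, Y] *
          outerSum G Λ θ (T'.map Function.Embedding.some) none ({some l} ∆ {none}) ∅ := by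
  obtain ⟨hTΛ, hb⟩ := map_some_subset_and_none (Λ := Λ) hT'
  have hnT : (none : Option V) ∉ T'.map Function.Embedding.some := (mem_sdiff.1 hb).2
  have haT : (some a : Option V) ∈ T'.map Function.Embedding.some := mem_map_of_mem _ ha
  have hkT : (some k : Option V) ∈ T'.map Function.Embedding.some := mem_map_of_mem _ hk
  have hlT : (some l : Option V) ∉ T'.map Function.Embedding.some := fun h => by
    obtain ⟨t, ht, htl⟩ := mem_map.1 h
    exact hl ((Option.some_injective _ htl) ▸ ht)
  obtain ⟨hf1, hf2⟩ := filter_pair_symmDiff_ghostPair_of_ghost_not_mem (V := V) hal hkl haT hkT hlT hnT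
  rw [currentPairSum_clusterCompl_eq θ hTΛ hb, hf1, hf2, filter_true_of_mem hY,
    filter_false_of_mem (fun v hv => not_not.2 (hY v hv))]

/-- **The per-cluster comparison** behind (5.28)–(5.29): for `T' ⊆ Λ` with `o, u, k ∈ T'`, `l ∉ T'`
(`u, k, o ≠ l`),
`∑_{X(u), {o*}∆{k*}} w w 𝟙[𝒮_g = T'*] ≤ ⟨σ_uσ_k⟩_{h=0} · ∑_{X(o), ∅} w w 𝟙[𝒮_g = T'*]`
in `ℝ`: both factorise through the same outer sum and the inner current sums differ by the ratio
`Z_T({u*}∆{k*})/Z_T(∅) = ⟨σ_uσ_k⟩_T ≤ ⟨σ_uσ_k⟩_{h=0}`. [cite: AizenmanFernandezJSP1986, §5.2, proof of Thm. 5.6, (5.29) and the inequality following it, pp. 433–434] -/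
theorem toReal_currentPairSum_hcluster_le {θ : Sym2 (Option V) → ℝ} (hθ : ∀ e, 0 ≤ θ e) {T' : Finset V}
    (hT' : T' ⊆ Λ) {o u k l : V} (ho : o ∈ T') (hu : u ∈ T') (hk : k ∈ T') (hl : l ∉ T') (hul : u ≠ l)
    (hkl : k ≠ l) (hol : o ≠ l) :
    (currentPairSum G Λ θ (({some u} ∆ {some k}) ∆ ({some l} ∆ {none})) ({some o} ∆ {some k})
        (fun m => ind (𝒮[m, none] = T'.map Function.Embedding.some))).toReal ≤
      thetaCorr G Λ (zeroField θ) ({u} ∆ {k}) *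
        (currentPairSum G Λ θ (({some o} ∆ {some k}) ∆ ({some l} ∆ {none})) ∅
          (fun m => ind (𝒮[m, none] = T'.map Function.Embedding.some))).toReal := by
  obtain ⟨hTΛ, -⟩ := map_some_subset_and_none (Λ := Λ) hT'
  have hY : ∀ v ∈ ({some o} ∆ {some k} : Finset (Option V)), v ∈ T'.map Function.Embedding.some := by
    intro v hv
    rcases mem_some_symmDiff_some hv with rfl | rfl
    · exact mem_map_of_mem _ ho
    · exact mem_map_of_mem _ hk
  rw [currentPairSum_pairGhost_hcluster_eq θ hT' hu hk hl hul hkl hY,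
    currentPairSum_pairGhost_hcluster_eq θ hT' ho hk hl hol hkl (Y := ∅) (fun v hv => absurd hv (notMem_empty v)),
    ENNReal.toReal_mul, ENNReal.toReal_mul, ENNReal.toReal_mul, ENNReal.toReal_mul]
  have huk : ({u} ∆ {k} : Finset V) ⊆ Λ :=
    symmDiff_le_sup.trans (sup_le (singleton_subset_iff.2 (hT' hu)) (singleton_subset_iff.2 (hT' hk)))
  have hcorr := corrIn_eq_gcurrentZ_div (G := G) (Λ := Λ) hθ hTΛ huk
  rw [starSet_pair] at hcorr
  have hle := corrIn_map_le_zeroField (G := G) (Λ := Λ) hθ T' huk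
  have hpos := toReal_gcurrentZ_in_pos (G := G) (Λ := Λ) hθ hTΛ
  set zuk := (ZIn[θ, T'.map Function.Embedding.some, {some u} ∆ {some k}]).toReal with hzuk
  set zok := (ZIn[θ, T'.map Function.Embedding.some, {some o} ∆ {some k}]).toReal with hzok
  set z0 := (ZIn[θ, T'.map Function.Embedding.some, ∅]).toReal with hz0
  set out := (outerSum G Λ θ (T'.map Function.Embedding.some) none ({some l} ∆ {none}) ∅).toReal with hout
  have h0 : 0 ≤ zok * out := mul_nonneg ENNReal.toReal_nonneg ENNReal.toReal_nonneg
  have hratio : zuk ≤ thetaCorr G Λ (zeroField θ) ({u} ∆ {k}) * z0 := by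
    rw [hcorr] at hle
    rwa [div_le_iff₀ hpos] at hle
  calc zuk * zok * out = zuk * (zok * out) := by ring
    _ ≤ (thetaCorr G Λ (zeroField θ) ({u} ∆ {k}) * z0) * (zok * out) := mul_le_mul_of_nonneg_right hratio h0
    _ = thetaCorr G Λ (zeroField θ) ({u} ∆ {k}) * (zok * z0 * out) := by ring

/-! ### The step (5.28)–(5.29): the weight of `{o ↮ g, o ⟷ k}` against `⟨σ_l⟩_{C^c(o)}` -/

/-- **Aizenman–Fernández (5.28)–(5.29)**: for `o, u, k, l ∈ Λ`, `k ≠ l`,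
`∑_{S ∋ g, S ∌ k} clusterWeight o u S · ⟨σ_l⟩_S ≤ ⟨σ_uσ_k⟩_{h=0} · afSZero o k l`
("the restriction `{k,l} ∈ C(0)` is, in the presence of the factor `⟨σ_l⟩_{C^c(0)}`, equivalent to
`0 → k`"; switch `{o,k}`, read `⟨σ_l⟩_{C^c}` back as sources `{l}*` (Lemma 3.3 at the cluster of
`o`), condition both sides on the `h`-cluster (Claim (5.29)) and compare the inner zero-field sums by
Griffiths II). [cite: AizenmanFernandezJSP1986, §5.2, proof of Thm. 5.6, eqs. (5.28)–(5.29), pp. 433–434] -/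
theorem sum_clusterWeight_corrIn_notMem_le {θ : Sym2 (Option V) → ℝ} (hθ : ∀ e, 0 ≤ θ e) {o u k l : V}
    (ho : o ∈ Λ) (hu : u ∈ Λ) (hk : k ∈ Λ) (hl : l ∈ Λ) (hkl : k ≠ l) :
    ∑ S ∈ (Λg).powerset.filter (fun S => (none : Option V) ∈ S ∧ (some k : Option V) ∉ S),
        clusterWeight G Λ θ o u S * corrIn G Λ θ S {l} ≤
      thetaCorr G Λ (zeroField θ) ({u} ∆ {k}) * afSZero G Λ θ o k l := by
  classical
  have huk : ({u} ∆ {k} : Finset V) ⊆ Λ :=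
    symmDiff_le_sup.trans (sup_le (singleton_subset_iff.2 hu) (singleton_subset_iff.2 hk))
  have hzf0 : 0 ≤ thetaCorr G Λ (zeroField θ) ({u} ∆ {k}) := thetaCorr_nonneg (zeroField_nonneg hθ) huk
  have hRHS0 : 0 ≤ thetaCorr G Λ (zeroField θ) ({u} ∆ {k}) * afSZero G Λ θ o k l :=
    mul_nonneg hzf0 (afSZero_nonneg hθ o k hl)
  -- the degenerate cases `u = l` and `o = l`: the left side vanishes
  have hdeg : ∀ w : V, w ∈ Λ → (w = o ∨ w = u) → w = l →
      ∑ S ∈ (Λg).powerset.filter (fun S => (none : Option V) ∈ S ∧ (some k : Option V) ∉ S),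
        clusterWeight G Λ θ o u S * corrIn G Λ θ S {l} = 0 := by
    intro w hw hwou hwl
    refine sum_eq_zero fun S hS => ?_
    rw [mem_filter, mem_powerset] at hS
    by_cases hwS : (some w : Option V) ∈ S
    · have : (some o : Option V) ∈ S ∨ (some u : Option V) ∈ S := by
        rcases hwou with rfl | rfl
        · exact Or.inl hwS
        · exact Or.inr hwS
      rw [clusterWeight_eq_zero_of_mem this, zero_mul]
    · rw [← hwl, corrIn_singleton_eq_zero hθ hS.1 hw hwS, mul_zero]
  by_cases hul : u = l
  · rw [hdeg u hu (Or.inr rfl) hul]; exact hRHS0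
  by_cases hol : o = l
  · rw [hdeg o ho (Or.inl rfl) hol]; exact hRHS0
  -- notation
  set Z : ℝ := (Zg[θ, ∅]).toReal with hZ
  have hZpos : 0 < Z := toReal_gcurrentZ_ghost_empty_pos subset_rfl hθ subset_rfl
  have hZ2 : 0 < Z ^ 2 := pow_pos hZpos 2
  set X₁ : Finset (Option V) := ({some u} ∆ {some k}) ∆ ({some l} ∆ {none}) with hX₁
  set X₂ : Finset (Option V) := ({some o} ∆ {some k}) ∆ ({some l} ∆ {none}) with hX₂
  set Y : Finset (Option V) := {some o} ∆ {some k} with hYdef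
  set F' := (Λg).powerset.filter (fun S => Claim1Side o u l S ∧ (some k : Option V) ∉ S) with hF'
  set P₁ : Finset V → ℝ≥0∞ := fun T' =>
    currentPairSum G Λ θ X₁ Y (fun m => ind (𝒮[m, none] = T'.map Function.Embedding.some)) with hP₁
  set P₂ : Finset V → ℝ≥0∞ := fun T' =>
    currentPairSum G Λ θ X₂ ∅ (fun m => ind (𝒮[m, none] = T'.map Function.Embedding.some)) with hP₂
  have hP₁fin : ∀ T', P₁ T' ≠ ∞ := fun T' => currentPairSum_ne_top hθ _ _ fun _ => ind_le_one _
  have hP₂fin : ∀ T', P₂ T' ≠ ∞ := fun T' => currentPairSum_ne_top hθ _ _ fun _ => ind_le_one _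
  -- Step 1: restrict the sum to the side conditions `g, l ∈ S`, `o, u, k ∉ S`
  have step1 : ∑ S ∈ (Λg).powerset.filter (fun S => (none : Option V) ∈ S ∧ (some k : Option V) ∉ S),
        clusterWeight G Λ θ o u S * corrIn G Λ θ S {l} =
      ∑ S ∈ F', corrIn G Λ θ S {l} * clusterWeight G Λ θ o u S := by
    have hsub : F' = ((Λg).powerset.filter (fun S => (none : Option V) ∈ S ∧ (some k : Option V) ∉ S)).filter
        (Claim1Side o u l) := by
      rw [hF', filter_filter]
      exact filter_congr fun S _ => ⟨fun h => ⟨⟨h.1.1, h.2⟩, h.1⟩, fun h => ⟨h.2, h.1.2⟩⟩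
    have hzero : ∀ S ∈ (Λg).powerset.filter (fun S => (none : Option V) ∈ S ∧ (some k : Option V) ∉ S),
        corrIn G Λ θ S {l} * clusterWeight G Λ θ o u S ≠ 0 → Claim1Side o u l S := by
      intro S hS hne
      rw [mem_filter, mem_powerset] at hS
      by_contra hC
      exact hne (by rw [mul_comm]; exact clusterWeight_mul_corrIn_eq_zero hθ hl hS.1 hS.2.1 hC)
    rw [hsub, sum_filter_of_ne hzero]
    exact sum_congr rfl fun S _ => mul_comm _ _
  -- Step 2: switch `{o,k}` and read `⟨σ_l⟩_S` back into the sources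
  have step2 : ∀ S ∈ F', corrIn G Λ θ S {l} * clusterWeight G Λ θ o u S =
      (currentPairSum G Λ θ X₁ Y (fun m => ind (𝒮[m, some o] = S))).toReal / Z ^ 2 := by
    intro S hS
    rw [hF', mem_filter, mem_powerset] at hS
    obtain ⟨hSΛ, ⟨hnS, hlS, hoS, huS⟩, hkS⟩ := hS
    have hYS : ∀ v ∈ Y, v ∉ S := by
      intro v hv
      rcases mem_some_symmDiff_some hv with rfl | rfl
      · exact hoS
      · exact hkS
    have key := toReal_pairSum_union_ghostPair_eq (G := G) (a := u) (k := k) hθ hSΛ ho hoS hl hlS hnS hul hkl huS hkS hYS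
    rw [hX₁, key, clusterWeight, currentPairSum_starSet_pair_clusterCompl_switch hθ hk hkS, ← hYdef, ← hZ]
    ring
  -- Step 3: the sum over `S` is the pair sum against the event, then over the `h`-cluster
  have step3 : ∑ S ∈ F', (currentPairSum G Λ θ X₁ Y (fun m => ind (𝒮[m, some o] = S))).toReal =
      ∑ T' ∈ Λ.powerset.filter (fun T' => o ∈ T' ∧ u ∈ T' ∧ k ∈ T' ∧ l ∉ T'), (P₁ T').toReal := by
    rw [← ENNReal.toReal_sum (fun S _ => currentPairSum_ne_top hθ _ _ fun _ => ind_le_one _),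
      ← currentPairSum_ind_mem_eq_sum,
      ← ENNReal.toReal_sum (fun T' _ => hP₁fin T')]
    congr 1
    refine currentPairSum_ind_eq_sum_hcluster θ _ fun n₁ n₂ h1 h2 => ?_
    rw [hF', mem_filter, mem_powerset, claim1Side_and_iff_hcluster hu hk hl hul hkl h1 h2,
      mem_eraseNone_clusterCompl_none_iff ho, mem_eraseNone_clusterCompl_none_iff hu,
      mem_eraseNone_clusterCompl_none_iff hk, mem_eraseNone_clusterCompl_none_iff hl, not_not]
    exact ⟨fun h => h.2, fun h => ⟨clusterCompl_subset _ _, h⟩⟩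
  -- Step 4: the same for `afSZero o k l`
  have step4 : afSZero G Λ θ o k l =
      (∑ T' ∈ Λ.powerset.filter (fun T' => o ∈ T' ∧ k ∈ T' ∧ l ∉ T'), (P₂ T').toReal) / Z ^ 2 := by
    have hdef : dctDelta G Λ θ o k l = currentPairSum G Λ θ X₂ ∅
        (fun m => ind (¬Conn[m, some o, none] ∧ ¬Conn[m, some o, some l] ∧ Conn[m, some o, some k])) := by
      rw [dctDelta, insertNone_triple]
    have hnum : (dctDelta G Λ θ o k l).toReal =
        ∑ T' ∈ Λ.powerset.filter (fun T' => o ∈ T' ∧ k ∈ T' ∧ l ∉ T'), (P₂ T').toReal := by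
      rw [← ENNReal.toReal_sum (fun T' _ => hP₂fin T'), hdef]
      congr 1
      refine currentPairSum_ind_eq_sum_hcluster θ _ fun n₁ n₂ h1 _ => ?_
      rw [dctDeltaEvent_iff_hcluster hol hkl h1, mem_eraseNone_clusterCompl_none_iff ho,
        mem_eraseNone_clusterCompl_none_iff hk, mem_eraseNone_clusterCompl_none_iff hl, not_not]
    rw [afSZero_eq_sum_claim1Side hθ o k hl, ← dctDelta_toReal_eq_sum hθ ho hk hl hkl, hnum, ← hZ]
  -- Step 5: compare cluster by cluster and enlarge the index set
  have step5 : ∑ T' ∈ Λ.powerset.filter (fun T' => o ∈ T' ∧ u ∈ T' ∧ k ∈ T' ∧ l ∉ T'), (P₁ T').toReal ≤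
      thetaCorr G Λ (zeroField θ) ({u} ∆ {k}) *
        ∑ T' ∈ Λ.powerset.filter (fun T' => o ∈ T' ∧ k ∈ T' ∧ l ∉ T'), (P₂ T').toReal := by
    calc ∑ T' ∈ Λ.powerset.filter (fun T' => o ∈ T' ∧ u ∈ T' ∧ k ∈ T' ∧ l ∉ T'), (P₁ T').toReal
        ≤ ∑ T' ∈ Λ.powerset.filter (fun T' => o ∈ T' ∧ u ∈ T' ∧ k ∈ T' ∧ l ∉ T'),
            thetaCorr G Λ (zeroField θ) ({u} ∆ {k}) * (P₂ T').toReal := by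
          refine sum_le_sum fun T' hT' => ?_
          rw [mem_filter, mem_powerset] at hT'
          obtain ⟨hT'Λ, hoT, huT, hkT, hlT⟩ := hT'
          exact toReal_currentPairSum_hcluster_le hθ hT'Λ hoT huT hkT hlT hul hkl hol
      _ ≤ ∑ T' ∈ Λ.powerset.filter (fun T' => o ∈ T' ∧ k ∈ T' ∧ l ∉ T'),
            thetaCorr G Λ (zeroField θ) ({u} ∆ {k}) * (P₂ T').toReal := by
          refine sum_le_sum_of_subset_of_nonneg (fun T' hT' => ?_) (fun T' _ _ => mul_nonneg hzf0 ENNReal.toReal_nonneg)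
          rw [mem_filter] at hT' ⊢
          exact ⟨hT'.1, hT'.2.1, hT'.2.2.2.1, hT'.2.2.2.2⟩
      _ = _ := by rw [← mul_sum]
  -- conclusion
  rw [step1, sum_congr rfl step2, ← sum_div, step3, step4, mul_div_assoc']
  exact div_le_div_of_nonneg_right step5 hZ2.le

end General

end Literature.Probability.LatticeModels
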